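import Literature.Barriers.FinalStateConjecture.ExtremalHorizonPointwiseDecayFromILED
import Literature.Geometry.Lorentzian.KerrStarMorawetzPositivity
import HarnessLib

/-!
# Barrier catalogue `FinalStateConjecture`: integrated local energy decay on the transition slab
# `{23M/21 ≤ r ≤ 8M/7}` for axisymmetric waves on extremal Kerr, by a physical-space Morawetz
# current (`Literature/Barriers/FinalStateConjecture/`, D-0021, D-0014; family `gr`)

Written from the proving seat of `Literature.Barriers.FinalStateConjecture.Aretakis2012_pointwiseDecay`
(Aretakis, JFA 263 (2012), Thm. 5). By `ExtremalHorizonPointwiseDecayFromILED.lean`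
(`Aretakis2012_pointwiseDecay_of_slabILED`) that named fact rests on exactly one input: for every
member of Aretakis's class, the spacetime integral of
`sin θ (M G² + M³((∂_{t*}G)² + (∂_rG)²) + M(∂_θG)²)` (`slabDensity`, `G = ψ ∘ κ`) over
`[0, τ] × {23M/21 ≤ r ≤ 8M/7} × [0, π]` is bounded uniformly in `τ ≥ 0` — the statement of Thm. 1
of the source (integrated local energy decay) restricted to a compact slab away from `𝓗⁺` and from
the effective photon sphere `r = (1 + √2)M`; the source proves Thm. 1 by frequency-localised
currents (§§8–12) and Giorgi–Wan (JFA 287 (2024) 110668) by one classical current. **This file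
proves that input** (`Kerr.slabILED_of_class`) from the globally non-negative physical-space current
of `KerrStarMorawetzPositivity.lean` (`X = f∂_{r*}`, `f = (r² − 2Mr − M²)/(r² + M²)`, Lagrangian
`(r − M)³/(r² + M²)² − b`, Hardy one-form `¼ψ²(Δṽ)∂_r^{BL}`; bulk `≥ 0` on `{r ≥ M}` and
`≥ 10⁻⁸M⁻² · slabDensity` on the slab):

* `Kerr.abs_multDensity_add_jDensity_le` (**the boundary densities are energy-bounded**): on
  `{r ≥ M}`, `|e_{X,w}| + e_J ≤ 7 e_T + 7 sin θ G²` pointwise (`e_T = tEnergy`, the degenerate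
  `T`-energy density; elementary weighted AM–GM bounds on the explicit profiles);
* `Kerr.morawetz_box_estimate` (**the estimate in coordinates**): for `G` smooth on an open set
  containing `[t₁, t₂] × [M, R] × [0, π]`, solving the separated equation off the axis, vanishing
  with its first derivatives on `{r = R}` (`R ≥ 8M/7`):
  `∫_{t₁}^{t₂}∫₀^π∫_{23M/21}^{8M/7} slabDensity ≤ 10¹⁰ M² ∫₀^π∫_M^R e_T(t₁)` — Stokes for the total
  current on the box (`box_divergence_identity` with the divergence identities
  `mult_divergence_eq_zero`, `j_identity`), the horizon face contributing the `T`-flux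
  `2M² sin θ (∂_{t*}G)²` (`= E_T(t₁) − E_T(t₂)`, `tEnergy_extremal_conservation`), the outer face
  nothing, the two leaves at most `63 E_T` each (the pointwise bound, the first Hardy inequality
  `line_sq_le_hardy` along the lines of the leaves, `E_T(t₂) ≤ E_T(t₁)`), and the bulk bounded below
  by `10⁻⁸M⁻²` times the slab integral (`gwGood_nonneg`, `gwGood_slab`);
* `Kerr.slabILED_of_class` (**the input of `Aretakis2012_pointwiseDecay_of_slabILED`**): for the
  class (global `C^∞` axisymmetric solutions on `U₀ ⊇ {r ≥ M, t* ≥ 0}` of the extremal Kerr–Schild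
  chart with data supported in `|x| ≤ ρ`), with `I = 10¹⁰ M² E_T(0; [M, max(ρ, 2M) + 2])`
  (finite speed of propagation `Kerr.fderiv_shellPoint_eq_zero_of_far` disposes of the outer face
  and `Kerr.tEnergy_data_far_eq` makes the data energy independent of the box).

Everything is proved; no named facts (D-0026). The discharge
`Aretakis2012_pointwiseDecay_holds` is the one-liner of `ExtremalHorizonAxisymmetricDecayProofs.lean`.

## References

* E. Giorgi, J. Wan, *Physical-space estimates for axisymmetric waves on extremal Kerr spacetime*,
  J. Funct. Anal. 287 (2024) 110668 (arXiv:2212.13164): Thm. 1.1, Cor. 1.2, §3.2 (the energy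
  identity), §3.4 (boundedness of the degenerate energy), §4.2 (key `GiorgiWan2024`).
* S. Aretakis, *Decay of axisymmetric solutions of the wave equation on extreme Kerr backgrounds*,
  J. Funct. Anal. 263 (2012) 2770–2831 (arXiv:1110.2006): Thm. 1, Prop. 12.5.1, §4.4 (Hardy),
  §5.1 (Prop. 5.1.2) (key `Aretakis2012`).
-/

noncomputable section

open Set Filter MeasureTheory intervalIntegral Real
open scoped Topology ContDiff Manifold

namespace Literature.Barriers.FinalStateConjecture.Kerr

open Literature.Geometry.Lorentzian
open Literature.Geometry.Lorentzian.Kerr.StarCoord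

/-! ### The boundary densities are bounded by the degenerate `T`-energy density and `sin θ G²` -/

section DensityBounds

variable {M : ℝ}

/-- Weighted AM–GM: `K u v ≤ a u² + b v²` when `K² ≤ 4ab`, `a, b ≥ 0`. [folklore] -/
theorem amgm_le {K a b : ℝ} (ha : 0 ≤ a) (hb : 0 ≤ b) (hK : K ^ 2 ≤ 4 * a * b) (u v : ℝ) :
    K * u * v ≤ a * u ^ 2 + b * v ^ 2 := by
  rcases ha.lt_or_eq with ha' | ha'
  · nlinarith [sq_nonneg (2 * a * u - K * v), mul_nonneg (sub_nonneg.2 hK) (sq_nonneg v)]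
  · rw [← ha'] at hK ⊢
    have hK0 : K = 0 := by nlinarith [sq_nonneg K]
    rw [hK0]
    nlinarith [mul_nonneg hb (sq_nonneg v)]

/-- Elementary facts on `{r ≥ M}` (`R2 = r² + M²`): `2M² ≤ R2`, `2Mr ≤ R2`, `(r − M)² ≤ R2`, `r² ≤ R2`,
`|r² − 2Mr − M²| ≤ R2`. [folklore] -/
theorem r_elem (hM : 0 < M) {r : ℝ} (hr : M ≤ r) :
    2 * M ^ 2 ≤ r ^ 2 + M ^ 2 ∧ 2 * M * r ≤ r ^ 2 + M ^ 2 ∧ (r - M) ^ 2 ≤ r ^ 2 + M ^ 2 ∧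
      r ^ 2 ≤ r ^ 2 + M ^ 2 ∧ |r ^ 2 - 2 * M * r - M ^ 2| ≤ r ^ 2 + M ^ 2 := by
  have hr0 : 0 ≤ r := hM.le.trans hr
  refine ⟨by nlinarith, by nlinarith [sq_nonneg (r - M)], by nlinarith, by nlinarith, ?_⟩
  rw [abs_le]
  constructor <;> nlinarith

/-- **Bounds on the profiles of the current at `r ≥ M`**: `|f̃|·2Mr ≤ Δ`, `f̃²(Σ + 2Mr) ≤ 2Δ`
(`f̃ = fΔ/R2`, `|f| ≤ 1`), `|h̃| ≤ 1` (`h̃ = 2Mrf/R2`), `|w| ≤ (r − M)²r/R2²`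
(`w = (r − M)³/R2² − b`), `0 ≤ ½MrΣṽ ≤ 2`. [cite: GiorgiWan2024, §4.1–4.2] -/
theorem profile_bounds (hM : 0 < M) {r c : ℝ} (hr : M ≤ r) (hc : c ^ 2 ≤ 1) :
    |mzProfileR M (gwSeed M) r| * (2 * M * r) ≤ (r - M) ^ 2 ∧
    mzProfileR M (gwSeed M) r ^ 2 * (r ^ 2 + M ^ 2 * c ^ 2 + 2 * M * r) ≤ 2 * (r - M) ^ 2 ∧
    |mzProfileT M (gwSeed M) r| ≤ 1 ∧
    |gwLag M r| ≤ (r - M) ^ 2 * r / (r ^ 2 + M ^ 2) ^ 2 ∧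
    0 ≤ 1 / 2 * M * r * (r ^ 2 + M ^ 2 * c ^ 2) * gwJ M r ∧
    1 / 2 * M * r * (r ^ 2 + M ^ 2 * c ^ 2) * gwJ M r ≤ 2 := by
  obtain ⟨h2M2, h2Mr, hΔ, hr2, hT⟩ := r_elem hM hr
  have hr0 : 0 ≤ r := hM.le.trans hr
  have hx : 0 ≤ r - M := sub_nonneg.2 hr
  have hR : 0 < r ^ 2 + M ^ 2 := by positivity
  have hSig : r ^ 2 + M ^ 2 * c ^ 2 + 2 * M * r ≤ 2 * (r ^ 2 + M ^ 2) := by nlinarith [sq_nonneg M]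
  have hSig0 : 0 ≤ r ^ 2 + M ^ 2 * c ^ 2 + 2 * M * r := by positivity
  have hSig1 : r ^ 2 + M ^ 2 * c ^ 2 ≤ r ^ 2 + M ^ 2 := by nlinarith [sq_nonneg M]
  -- the seed is bounded by one
  have hf : |gwSeed M r| ≤ 1 := by
    unfold gwSeed
    rw [abs_div, abs_of_pos hR, div_le_one hR]
    exact hT
  have hf0 : 0 ≤ |gwSeed M r| := abs_nonneg _
  have hf2 : gwSeed M r ^ 2 ≤ 1 := by
    have := sq_abs (gwSeed M r)
    nlinarith [abs_nonneg (gwSeed M r)]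
  refine ⟨?_, ?_, ?_, ?_, ?_, ?_⟩
  · -- `|f Δ/R2| 2Mr ≤ Δ`
    have h : |mzProfileR M (gwSeed M) r| = |gwSeed M r| * (r - M) ^ 2 / (r ^ 2 + M ^ 2) := by
      unfold mzProfileR
      rw [abs_div, abs_mul, abs_of_nonneg (sq_nonneg (r - M)), abs_of_pos hR]
    rw [h, div_mul_eq_mul_div, div_le_iff₀ hR]
    have := mul_le_mul hf h2Mr (by positivity) zero_le_one
    nlinarith [mul_nonneg hf0 (sq_nonneg (r - M))]
  · -- `f̃² Σ' ≤ 2Δ`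
    have h : mzProfileR M (gwSeed M) r ^ 2 = gwSeed M r ^ 2 * ((r - M) ^ 2) ^ 2 / (r ^ 2 + M ^ 2) ^ 2 := by
      unfold mzProfileR
      rw [div_pow, mul_pow]
    rw [h, div_mul_eq_mul_div, div_le_iff₀ (by positivity)]
    have h1 : gwSeed M r ^ 2 * ((r - M) ^ 2) ^ 2 * (r ^ 2 + M ^ 2 * c ^ 2 + 2 * M * r) ≤
        1 * ((r - M) ^ 2) ^ 2 * (2 * (r ^ 2 + M ^ 2)) :=
      mul_le_mul (mul_le_mul_of_nonneg_right hf2 (by positivity)) hSig hSig0 (by positivity)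
    nlinarith [mul_le_mul_of_nonneg_left hΔ (sq_nonneg (r - M)), hR]
  · -- `|h̃| ≤ 1`
    unfold mzProfileT
    rw [abs_div, abs_of_pos hR, div_le_one hR, abs_mul, abs_of_nonneg (by positivity : (0 : ℝ) ≤ 2 * M * r)]
    nlinarith [mul_le_mul_of_nonneg_left hf (by positivity : (0 : ℝ) ≤ 2 * M * r)]
  · -- `|w| ≤ (r−M)² r/R2²`
    have hw : gwLag M r = (r - M) ^ 3 / (r ^ 2 + M ^ 2) ^ 2 - gwBump M r := by
      unfold gwLag; rw [mzProfileW_gwSeed hM.ne']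
    have hb0 := gwBump_nonneg hM.le r
    have hbup : gwBump M r ≤ M / 20 * (r - M) ^ 2 / (r ^ 2 + M ^ 2) ^ 2 := by
      unfold gwBump
      rw [div_le_div_iff₀ (by positivity) (by positivity)]
      have hT2 : (r ^ 2 - 2 * M * r - M ^ 2) ^ 2 ≤ (r ^ 2 + M ^ 2) ^ 2 := by
        have := sq_abs (r ^ 2 - 2 * M * r - M ^ 2)
        nlinarith [abs_nonneg (r ^ 2 - 2 * M * r - M ^ 2)]
      have h0 : 0 ≤ M / 20 * (r - M) ^ 2 * (r ^ 2 + M ^ 2) ^ 2 := by positivity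
      have := mul_le_mul_of_nonneg_left hT2 h0
      have e : M / 20 * (r - M) ^ 2 * (r ^ 2 + M ^ 2) ^ 4 =
          M / 20 * (r - M) ^ 2 * (r ^ 2 + M ^ 2) ^ 2 * (r ^ 2 + M ^ 2) ^ 2 := by ring
      rw [e]
      linarith
    have h2 : M / 20 * (r - M) ^ 2 / (r ^ 2 + M ^ 2) ^ 2 ≤ (r - M) ^ 2 * r / (r ^ 2 + M ^ 2) ^ 2 := by
      rw [div_le_div_iff₀ (by positivity) (by positivity)]
      have : M / 20 * (r - M) ^ 2 ≤ (r - M) ^ 2 * r := by nlinarith [sq_nonneg (r - M)]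
      exact mul_le_mul_of_nonneg_right this (by positivity)
    have h3 : (r - M) ^ 3 / (r ^ 2 + M ^ 2) ^ 2 ≤ (r - M) ^ 2 * r / (r ^ 2 + M ^ 2) ^ 2 := by
      rw [div_le_div_iff₀ (by positivity) (by positivity)]
      have : (r - M) ^ 3 ≤ (r - M) ^ 2 * r := by nlinarith [sq_nonneg (r - M)]
      exact mul_le_mul_of_nonneg_right this (by positivity)
    have h1 : 0 ≤ (r - M) ^ 3 / (r ^ 2 + M ^ 2) ^ 2 := by positivity
    rw [hw, abs_le]
    constructor <;> linarith
  · unfold gwJ; positivity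
  · unfold gwJ
    rw [show 1 / 2 * M * r * (r ^ 2 + M ^ 2 * c ^ 2) * (7 * M * r ^ 2 * (r - M) / (r ^ 2 + M ^ 2) ^ 4) =
      7 / 2 * M ^ 2 * r ^ 3 * (r - M) * (r ^ 2 + M ^ 2 * c ^ 2) / (r ^ 2 + M ^ 2) ^ 4 by ring]
    rw [div_le_iff₀ (by positivity)]
    have hr3 : r ^ 3 * (r - M) ≤ (r ^ 2 + M ^ 2) ^ 2 := by
      nlinarith [sq_nonneg r, sq_nonneg M, mul_nonneg hr0 hx, mul_nonneg (mul_nonneg hr0 hr0) (sq_nonneg M)]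
    have h1 : M ^ 2 * (r ^ 3 * (r - M)) ≤ (r ^ 2 + M ^ 2) / 2 * (r ^ 2 + M ^ 2) ^ 2 :=
      mul_le_mul (by linarith) hr3 (by positivity) (by positivity)
    have h2 := mul_le_mul h1 hSig1 (by positivity) (by positivity)
    nlinarith [pow_pos hR 3, pow_pos hR 4]

/-- **The algebraic heart of the density bound** (real variables): with `Σ' = r² + M²c² + 2Mr`,
`e_T = ½ s (Δ g₁² + Σ' g₀² + g₂²)`, profiles `F, H, w` obeying the bounds of `profile_bounds` and
`0 ≤ J ≤ 2`:
`|s(F(2Mr g₁² − Σ' g₁g₀)) − H e_T + s w(4Mr g g₁ + M g² − Σ' g g₀)| + J s g² ≤ 7 e_T + 7 s g²`.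
[cite: GiorgiWan2024, §4.2] -/
theorem density_poly_bound (hM : 0 < M) {r s c g g₀ g₁ g₂ F H w J : ℝ} (hr : M ≤ r) (hs : 0 ≤ s)
    (hc : c ^ 2 ≤ 1) (hF1 : |F| * (2 * M * r) ≤ (r - M) ^ 2)
    (hF2 : F ^ 2 * (r ^ 2 + M ^ 2 * c ^ 2 + 2 * M * r) ≤ 2 * (r - M) ^ 2) (hH : |H| ≤ 1)
    (hW : |w| ≤ (r - M) ^ 2 * r / (r ^ 2 + M ^ 2) ^ 2) (hJ : J ≤ 2) :
    |s * (F * (2 * M * r * g₁ ^ 2 - (r ^ 2 + M ^ 2 * c ^ 2 + 2 * M * r) * g₁ * g₀)) -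
          H * (1 / 2 * s * ((r - M) ^ 2 * g₁ ^ 2 + (r ^ 2 + M ^ 2 * c ^ 2 + 2 * M * r) * g₀ ^ 2 + g₂ ^ 2)) +
          s * (w * (4 * M * r * g * g₁ + M * g ^ 2 - (r ^ 2 + M ^ 2 * c ^ 2 + 2 * M * r) * g * g₀))| +
        J * (s * g ^ 2) ≤
      7 * (1 / 2 * s * ((r - M) ^ 2 * g₁ ^ 2 + (r ^ 2 + M ^ 2 * c ^ 2 + 2 * M * r) * g₀ ^ 2 + g₂ ^ 2)) +
        7 * (s * g ^ 2) := by
  obtain ⟨h2M2, h2Mr, hΔ, hr2, -⟩ := r_elem hM hr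
  have hr0 : 0 ≤ r := hM.le.trans hr
  have hx : 0 ≤ r - M := sub_nonneg.2 hr
  have hR : 0 < r ^ 2 + M ^ 2 := by positivity
  have hSig0 : 0 ≤ r ^ 2 + M ^ 2 * c ^ 2 + 2 * M * r := by positivity
  have hSig2 : r ^ 2 + M ^ 2 * c ^ 2 + 2 * M * r ≤ 2 * (r ^ 2 + M ^ 2) := by nlinarith [sq_nonneg M]
  have hF0 : 0 ≤ |F| := abs_nonneg _
  have hw0 : 0 ≤ |w| := abs_nonneg _
  -- (1) the radial multiplier bracket
  have hA1 : |F * (2 * M * r * g₁ ^ 2)| ≤ (r - M) ^ 2 * g₁ ^ 2 := by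
    rw [abs_mul, abs_of_nonneg (by positivity : (0 : ℝ) ≤ 2 * M * r * g₁ ^ 2)]
    have h := mul_le_mul_of_nonneg_right hF1 (sq_nonneg g₁)
    have e : |F| * (2 * M * r * g₁ ^ 2) = |F| * (2 * M * r) * g₁ ^ 2 := by ring
    rw [e]
    exact h
  have hA2 : |F * ((r ^ 2 + M ^ 2 * c ^ 2 + 2 * M * r) * g₁ * g₀)| ≤
      (r - M) ^ 2 * g₁ ^ 2 + 1 / 2 * (r ^ 2 + M ^ 2 * c ^ 2 + 2 * M * r) * g₀ ^ 2 := by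
    have hK : (|F| * (r ^ 2 + M ^ 2 * c ^ 2 + 2 * M * r)) ^ 2 ≤
        4 * (r - M) ^ 2 * (1 / 2 * (r ^ 2 + M ^ 2 * c ^ 2 + 2 * M * r)) := by
      rw [mul_pow, sq_abs]
      have h := mul_le_mul_of_nonneg_right hF2 hSig0
      have e1 : F ^ 2 * (r ^ 2 + M ^ 2 * c ^ 2 + 2 * M * r) ^ 2 =
          F ^ 2 * (r ^ 2 + M ^ 2 * c ^ 2 + 2 * M * r) * (r ^ 2 + M ^ 2 * c ^ 2 + 2 * M * r) := by ring
      have e2 : 4 * (r - M) ^ 2 * (1 / 2 * (r ^ 2 + M ^ 2 * c ^ 2 + 2 * M * r)) =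
          2 * (r - M) ^ 2 * (r ^ 2 + M ^ 2 * c ^ 2 + 2 * M * r) := by ring
      rw [e1, e2]
      exact h
    have h := amgm_le (sq_nonneg (r - M)) (by positivity) hK (|g₁|) (|g₀|)
    rw [sq_abs, sq_abs] at h
    calc |F * ((r ^ 2 + M ^ 2 * c ^ 2 + 2 * M * r) * g₁ * g₀)|
        = |F| * (r ^ 2 + M ^ 2 * c ^ 2 + 2 * M * r) * |g₁| * |g₀| := by
          rw [abs_mul, abs_mul, abs_mul, abs_of_nonneg hSig0]; ring
      _ ≤ (r - M) ^ 2 * g₁ ^ 2 + 1 / 2 * (r ^ 2 + M ^ 2 * c ^ 2 + 2 * M * r) * g₀ ^ 2 := h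
  have hA : |s * (F * (2 * M * r * g₁ ^ 2 - (r ^ 2 + M ^ 2 * c ^ 2 + 2 * M * r) * g₁ * g₀))| ≤
      s * (2 * (r - M) ^ 2 * g₁ ^ 2 + 1 / 2 * (r ^ 2 + M ^ 2 * c ^ 2 + 2 * M * r) * g₀ ^ 2) := by
    rw [abs_mul, abs_of_nonneg hs]
    refine mul_le_mul_of_nonneg_left ?_ hs
    have e : F * (2 * M * r * g₁ ^ 2 - (r ^ 2 + M ^ 2 * c ^ 2 + 2 * M * r) * g₁ * g₀) =
        F * (2 * M * r * g₁ ^ 2) - F * ((r ^ 2 + M ^ 2 * c ^ 2 + 2 * M * r) * g₁ * g₀) := by ring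
    rw [e]
    exact (abs_sub _ _).trans (by linarith only [hA1, hA2])
  -- (2) the time multiplier term
  have hT0 : 0 ≤ 1 / 2 * s * ((r - M) ^ 2 * g₁ ^ 2 + (r ^ 2 + M ^ 2 * c ^ 2 + 2 * M * r) * g₀ ^ 2 + g₂ ^ 2) := by
    positivity
  have hB : |H * (1 / 2 * s * ((r - M) ^ 2 * g₁ ^ 2 + (r ^ 2 + M ^ 2 * c ^ 2 + 2 * M * r) * g₀ ^ 2 + g₂ ^ 2))| ≤
      1 / 2 * s * ((r - M) ^ 2 * g₁ ^ 2 + (r ^ 2 + M ^ 2 * c ^ 2 + 2 * M * r) * g₀ ^ 2 + g₂ ^ 2) := by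
    rw [abs_mul, abs_of_nonneg hT0]
    have h := mul_le_mul_of_nonneg_right hH hT0
    linarith only [h]
  -- (3) the Lagrangian bracket
  have hC1 : |w * (4 * M * r * g * g₁)| ≤ (r - M) ^ 2 * g₁ ^ 2 + 2 * g ^ 2 := by
    have hK : (|w| * (4 * M * r)) ^ 2 ≤ 4 * (r - M) ^ 2 * 2 := by
      have h4Mr : (0 : ℝ) ≤ 4 * M * r := by positivity
      have h1 : (|w| * (4 * M * r)) ^ 2 ≤ ((r - M) ^ 2 * r / (r ^ 2 + M ^ 2) ^ 2 * (4 * M * r)) ^ 2 :=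
        pow_le_pow_left₀ (mul_nonneg hw0 h4Mr) (mul_le_mul_of_nonneg_right hW h4Mr) 2
      refine h1.trans ?_
      have hR4 : (0 : ℝ) < ((r ^ 2 + M ^ 2) ^ 2) ^ 2 := by positivity
      rw [div_mul_eq_mul_div, div_pow, div_le_iff₀ hR4]
      have hr4 : (r ^ 2) ^ 2 ≤ (r ^ 2 + M ^ 2) ^ 2 := pow_le_pow_left₀ (sq_nonneg r) hr2 2
      have h3 : 2 * M ^ 2 * (r ^ 2) ^ 2 * (r - M) ^ 2 ≤ (r ^ 2 + M ^ 2) * (r ^ 2 + M ^ 2) ^ 2 * (r ^ 2 + M ^ 2) :=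
        mul_le_mul (mul_le_mul h2M2 hr4 (by positivity) (by positivity)) hΔ (sq_nonneg _) (by positivity)
      have h3' := mul_le_mul_of_nonneg_right h3 (sq_nonneg (r - M))
      have e1 : ((r - M) ^ 2 * r * (4 * M * r)) ^ 2 = 8 * (2 * M ^ 2 * (r ^ 2) ^ 2 * (r - M) ^ 2 * (r - M) ^ 2) := by
        ring
      have e2 : 4 * (r - M) ^ 2 * 2 * ((r ^ 2 + M ^ 2) ^ 2) ^ 2 =
          8 * ((r ^ 2 + M ^ 2) * (r ^ 2 + M ^ 2) ^ 2 * (r ^ 2 + M ^ 2) * (r - M) ^ 2) := by ring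
      rw [e1, e2]
      linarith only [h3']
    have h := amgm_le (sq_nonneg (r - M)) (by norm_num) hK (|g₁|) (|g|)
    rw [sq_abs, sq_abs] at h
    calc |w * (4 * M * r * g * g₁)| = |w| * (4 * M * r) * |g₁| * |g| := by
          rw [abs_mul, abs_mul, abs_mul, abs_of_nonneg (by positivity : (0 : ℝ) ≤ 4 * M * r)]; ring
      _ ≤ (r - M) ^ 2 * g₁ ^ 2 + 2 * g ^ 2 := h
  have hC2 : |w * (M * g ^ 2)| ≤ 1 / 2 * g ^ 2 := by
    rw [abs_mul, abs_of_nonneg (by positivity : (0 : ℝ) ≤ M * g ^ 2)]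
    have hwM : |w| * M ≤ 1 / 2 := by
      refine (mul_le_mul_of_nonneg_right hW hM.le).trans ?_
      rw [div_mul_eq_mul_div, div_le_iff₀ (by positivity)]
      have h := mul_le_mul h2Mr hΔ (sq_nonneg _) hR.le
      calc (r - M) ^ 2 * r * M = 1 / 2 * (2 * M * r * (r - M) ^ 2) := by ring
        _ ≤ 1 / 2 * ((r ^ 2 + M ^ 2) * (r ^ 2 + M ^ 2)) := by linarith only [h]
        _ = 1 / 2 * (r ^ 2 + M ^ 2) ^ 2 := by ring
    have h := mul_le_mul_of_nonneg_right hwM (sq_nonneg g)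
    have e : |w| * (M * g ^ 2) = |w| * M * g ^ 2 := by ring
    rw [e]
    linarith only [h]
  have hC3 : |w * ((r ^ 2 + M ^ 2 * c ^ 2 + 2 * M * r) * g * g₀)| ≤
      1 / 2 * (r ^ 2 + M ^ 2 * c ^ 2 + 2 * M * r) * g₀ ^ 2 + 2 * g ^ 2 := by
    have hK : (|w| * (r ^ 2 + M ^ 2 * c ^ 2 + 2 * M * r)) ^ 2 ≤
        4 * (1 / 2 * (r ^ 2 + M ^ 2 * c ^ 2 + 2 * M * r)) * 2 := by
      have hw2 : |w| ^ 2 ≤ ((r - M) ^ 2 * r / (r ^ 2 + M ^ 2) ^ 2) ^ 2 := pow_le_pow_left₀ hw0 hW 2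
      have hw2' : |w| ^ 2 * (r ^ 2 + M ^ 2) ≤ 1 := by
        refine (mul_le_mul_of_nonneg_right hw2 hR.le).trans ?_
        rw [div_pow, div_mul_eq_mul_div, div_le_one (by positivity)]
        have h4 : ((r - M) ^ 2) ^ 2 ≤ (r ^ 2 + M ^ 2) ^ 2 := pow_le_pow_left₀ (sq_nonneg _) hΔ 2
        have h5 : ((r - M) ^ 2) ^ 2 * r ^ 2 ≤ (r ^ 2 + M ^ 2) ^ 2 * (r ^ 2 + M ^ 2) :=
          mul_le_mul h4 hr2 (sq_nonneg r) (by positivity)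
        have h6 := mul_le_mul_of_nonneg_right h5 hR.le
        calc ((r - M) ^ 2 * r) ^ 2 * (r ^ 2 + M ^ 2) = ((r - M) ^ 2) ^ 2 * r ^ 2 * (r ^ 2 + M ^ 2) := by ring
          _ ≤ (r ^ 2 + M ^ 2) ^ 2 * (r ^ 2 + M ^ 2) * (r ^ 2 + M ^ 2) := h6
          _ = ((r ^ 2 + M ^ 2) ^ 2) ^ 2 := by ring
      rw [mul_pow]
      have h7 := mul_le_mul_of_nonneg_left hSig2 (sq_nonneg (|w|))
      have h9 := mul_le_mul_of_nonneg_right h7 hSig0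
      have h10 := mul_le_mul_of_nonneg_right hw2' hSig0
      have e3 : |w| ^ 2 * (r ^ 2 + M ^ 2 * c ^ 2 + 2 * M * r) ^ 2 =
          |w| ^ 2 * (r ^ 2 + M ^ 2 * c ^ 2 + 2 * M * r) * (r ^ 2 + M ^ 2 * c ^ 2 + 2 * M * r) := by ring
      have e4 : |w| ^ 2 * (2 * (r ^ 2 + M ^ 2)) * (r ^ 2 + M ^ 2 * c ^ 2 + 2 * M * r) =
          2 * (|w| ^ 2 * (r ^ 2 + M ^ 2) * (r ^ 2 + M ^ 2 * c ^ 2 + 2 * M * r)) := by ring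
      have e5 : 4 * (1 / 2 * (r ^ 2 + M ^ 2 * c ^ 2 + 2 * M * r)) * 2 =
          4 * (1 * (r ^ 2 + M ^ 2 * c ^ 2 + 2 * M * r)) := by ring
      rw [e3, e5]
      rw [e4] at h9
      linarith only [h9, h10, hSig0]
    have h := amgm_le (by positivity : (0 : ℝ) ≤ 1 / 2 * (r ^ 2 + M ^ 2 * c ^ 2 + 2 * M * r)) (by norm_num)
      hK (|g₀|) (|g|)
    rw [sq_abs, sq_abs] at h
    calc |w * ((r ^ 2 + M ^ 2 * c ^ 2 + 2 * M * r) * g * g₀)|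
        = |w| * (r ^ 2 + M ^ 2 * c ^ 2 + 2 * M * r) * |g₀| * |g| := by
          rw [abs_mul, abs_mul, abs_mul, abs_of_nonneg hSig0]; ring
      _ ≤ 1 / 2 * (r ^ 2 + M ^ 2 * c ^ 2 + 2 * M * r) * g₀ ^ 2 + 2 * g ^ 2 := h
  have hC : |s * (w * (4 * M * r * g * g₁ + M * g ^ 2 - (r ^ 2 + M ^ 2 * c ^ 2 + 2 * M * r) * g * g₀))| ≤
      s * ((r - M) ^ 2 * g₁ ^ 2 + 1 / 2 * (r ^ 2 + M ^ 2 * c ^ 2 + 2 * M * r) * g₀ ^ 2 + 9 / 2 * g ^ 2) := by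
    rw [abs_mul, abs_of_nonneg hs]
    refine mul_le_mul_of_nonneg_left ?_ hs
    have e : w * (4 * M * r * g * g₁ + M * g ^ 2 - (r ^ 2 + M ^ 2 * c ^ 2 + 2 * M * r) * g * g₀) =
        w * (4 * M * r * g * g₁) + w * (M * g ^ 2) - w * ((r ^ 2 + M ^ 2 * c ^ 2 + 2 * M * r) * g * g₀) := by
      ring
    rw [e]
    have t1 : |w * (4 * M * r * g * g₁) + w * (M * g ^ 2) - w * ((r ^ 2 + M ^ 2 * c ^ 2 + 2 * M * r) * g * g₀)| ≤
        |w * (4 * M * r * g * g₁) + w * (M * g ^ 2)| + |w * ((r ^ 2 + M ^ 2 * c ^ 2 + 2 * M * r) * g * g₀)| :=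
      abs_sub _ _
    have t2 : |w * (4 * M * r * g * g₁) + w * (M * g ^ 2)| ≤ |w * (4 * M * r * g * g₁)| + |w * (M * g ^ 2)| :=
      abs_add_le _ _
    linarith only [t1, t2, hC1, hC2, hC3]
  -- assemble
  have habs1 : |s * (F * (2 * M * r * g₁ ^ 2 - (r ^ 2 + M ^ 2 * c ^ 2 + 2 * M * r) * g₁ * g₀)) -
          H * (1 / 2 * s * ((r - M) ^ 2 * g₁ ^ 2 + (r ^ 2 + M ^ 2 * c ^ 2 + 2 * M * r) * g₀ ^ 2 + g₂ ^ 2)) +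
          s * (w * (4 * M * r * g * g₁ + M * g ^ 2 - (r ^ 2 + M ^ 2 * c ^ 2 + 2 * M * r) * g * g₀))| ≤
      |s * (F * (2 * M * r * g₁ ^ 2 - (r ^ 2 + M ^ 2 * c ^ 2 + 2 * M * r) * g₁ * g₀)) -
          H * (1 / 2 * s * ((r - M) ^ 2 * g₁ ^ 2 + (r ^ 2 + M ^ 2 * c ^ 2 + 2 * M * r) * g₀ ^ 2 + g₂ ^ 2))| +
        |s * (w * (4 * M * r * g * g₁ + M * g ^ 2 - (r ^ 2 + M ^ 2 * c ^ 2 + 2 * M * r) * g * g₀))| :=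
    abs_add_le _ _
  have habs2 : |s * (F * (2 * M * r * g₁ ^ 2 - (r ^ 2 + M ^ 2 * c ^ 2 + 2 * M * r) * g₁ * g₀)) -
          H * (1 / 2 * s * ((r - M) ^ 2 * g₁ ^ 2 + (r ^ 2 + M ^ 2 * c ^ 2 + 2 * M * r) * g₀ ^ 2 + g₂ ^ 2))| ≤
      |s * (F * (2 * M * r * g₁ ^ 2 - (r ^ 2 + M ^ 2 * c ^ 2 + 2 * M * r) * g₁ * g₀))| +
        |H * (1 / 2 * s * ((r - M) ^ 2 * g₁ ^ 2 + (r ^ 2 + M ^ 2 * c ^ 2 + 2 * M * r) * g₀ ^ 2 + g₂ ^ 2))| :=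
    abs_sub _ _
  have hJs : J * (s * g ^ 2) ≤ 2 * (s * g ^ 2) := mul_le_mul_of_nonneg_right hJ (by positivity)
  have hg2 : 0 ≤ s * g₂ ^ 2 := by positivity
  have hsg : 0 ≤ s * g ^ 2 := mul_nonneg hs (sq_nonneg g)
  have hsg1 : 0 ≤ s * ((r - M) ^ 2 * g₁ ^ 2) := by positivity
  have hsg0 : 0 ≤ s * ((r ^ 2 + M ^ 2 * c ^ 2 + 2 * M * r) * g₀ ^ 2) := by positivity
  have hsg2 : 0 ≤ s * g₂ ^ 2 := by positivity
  linarith only [habs1, habs2, hA, hB, hC, hJs, hsg, hsg1, hsg0, hsg2]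

/-- **The boundary densities of the current are bounded by the degenerate `T`-energy density and
`sin θ G²`**: on `{r ≥ M}`, `θ ∈ [0, π]`,
`|multDensity(f̃, h̃, w)| + jDensity(ṽ) ≤ 7·tEnergy + 7 sin θ G²`. [cite: GiorgiWan2024, §4.2 and §3.4] -/
theorem abs_multDensity_add_jDensity_le (hM : 0 < M) (G : E4 → ℝ) {q : E4} (hr : M ≤ q 1)
    (hθ : q 2 ∈ Icc 0 π) :
    |multDensity M M (mzProfileR M (gwSeed M)) (mzProfileT M (gwSeed M)) (gwLag M) G q| +
        jDensity M (gwJ M) G q ≤ 7 * tEnergy M M G q + 7 * (sin (q 2) * G q ^ 2) := by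
  have hs : 0 ≤ sin (q 2) := sin_nonneg_of_nonneg_of_le_pi hθ.1 hθ.2
  have hc : cos (q 2) ^ 2 ≤ 1 := by
    have := sin_sq_add_cos_sq (q 2); nlinarith [sq_nonneg (sin (q 2))]
  obtain ⟨hF1, hF2, hH, hW, -, hJ⟩ := profile_bounds hM hr hc
  have key := density_poly_bound hM hr hs hc hF1 hF2 hH hW hJ (g := G q) (g₀ := pd 0 G q)
    (g₁ := pd 1 G q) (g₂ := pd 2 G q)
  have e1 : multDensity M M (mzProfileR M (gwSeed M)) (mzProfileT M (gwSeed M)) (gwLag M) G q =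
      sin (q 2) * (mzProfileR M (gwSeed M) (q 1) * (2 * M * q 1 * pd 1 G q ^ 2 -
          (q 1 ^ 2 + M ^ 2 * cos (q 2) ^ 2 + 2 * M * q 1) * pd 1 G q * pd 0 G q)) -
        mzProfileT M (gwSeed M) (q 1) * (1 / 2 * sin (q 2) * ((q 1 - M) ^ 2 * pd 1 G q ^ 2 +
          (q 1 ^ 2 + M ^ 2 * cos (q 2) ^ 2 + 2 * M * q 1) * pd 0 G q ^ 2 + pd 2 G q ^ 2)) +
        sin (q 2) * (gwLag M (q 1) * (4 * M * q 1 * G q * pd 1 G q + M * G q ^ 2 -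
          (q 1 ^ 2 + M ^ 2 * cos (q 2) ^ 2 + 2 * M * q 1) * G q * pd 0 G q)) := by
    simp only [multDensity, radMultDensity, timeMultDensity, lagDensity, tEnergy]
    ring
  have e2 : jDensity M (gwJ M) G q =
      1 / 2 * M * q 1 * (q 1 ^ 2 + M ^ 2 * cos (q 2) ^ 2) * gwJ M (q 1) * (sin (q 2) * G q ^ 2) := by
    simp only [jDensity]; ring
  have e3 : tEnergy M M G q = 1 / 2 * sin (q 2) * ((q 1 - M) ^ 2 * pd 1 G q ^ 2 +
      (q 1 ^ 2 + M ^ 2 * cos (q 2) ^ 2 + 2 * M * q 1) * pd 0 G q ^ 2 + pd 2 G q ^ 2) := by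
    simp only [tEnergy]; ring
  rw [e1, e2, e3]
  exact key

end DensityBounds

/-! ### The Morawetz estimate in coordinates -/

section Coord

variable {M : ℝ} {W₀ : Set E4} {G : E4 → ℝ}

/-- The Hardy density is non-negative on `{r ≥ M}`, `θ ∈ [0, π]`. [cite: GiorgiWan2024, §4.2] -/
theorem jDensity_nonneg (hM : 0 < M) (G : E4 → ℝ) {q : E4} (hr : M ≤ q 1) (hθ : q 2 ∈ Icc 0 π) :
    0 ≤ jDensity M (gwJ M) G q := by
  have hs : 0 ≤ sin (q 2) := sin_nonneg_of_nonneg_of_le_pi hθ.1 hθ.2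
  have hc : cos (q 2) ^ 2 ≤ 1 := by
    have := sin_sq_add_cos_sq (q 2); nlinarith [sq_nonneg (sin (q 2))]
  obtain ⟨-, -, -, -, hJ0, -⟩ := profile_bounds hM hr hc
  have e2 : jDensity M (gwJ M) G q =
      1 / 2 * M * q 1 * (q 1 ^ 2 + M ^ 2 * cos (q 2) ^ 2) * gwJ M (q 1) * (sin (q 2) * G q ^ 2) := by
    simp only [jDensity]; ring
  rw [e2]
  exact mul_nonneg hJ0 (by positivity)
set_option maxHeartbeats 400000 in -- buildfix (bf3-g26): 160k/180k FAIL, 200k PASS at accept time; line-neutral budget line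
/-- **The Morawetz estimate in coordinates.** Let `G` be smooth on an open `W₀` containing the box
`[t₁, t₂] × [M, R] × [0, π]` (at `φ₀`), solve the separated equation `𝓡G + 𝓐G = 0` off the axis
on `W₀`, and vanish together with its first derivatives on the outer face `{r = R}`, `R ≥ 8M/7`.
Then
`∫_{t₁}^{t₂}∫₀^π∫_{23M/21}^{8M/7} slabDensity ≤ 127·10⁸ M² ∫₀^π∫_M^R tEnergy(t₁)`.
Proof: Stokes on the box for the total current (multiplier part of `KerrStarMorawetzPositivity`
plus the Hardy current), whose bulk is `≥ 0` on the box and `≥ 10⁻⁸M⁻² slabDensity` on the slab,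
whose horizon flux is the `T`-flux `2M² sin θ (∂_{t*}G)² = E_T(t₁) − E_T(t₂)`, whose outer flux
vanishes, and whose leaf terms are at most `63 E_T` each (pointwise bound, first Hardy inequality
along the lines of the leaves, monotonicity of `E_T`). [cite: GiorgiWan2024, Thm. 1.1 and Cor. 1.2] -/
theorem morawetz_box_estimate (hM : 0 < M) (hW₀ : IsOpen W₀) (hG : ContDiffOn ℝ ∞ G W₀)
    (hP : ∀ q ∈ W₀, sin (q 2) ≠ 0 → radOp M M G q + angOp M G q = 0)
    {t₁ t₂ R φ₀ : ℝ} (ht : t₁ ≤ t₂) (hR : 8 / 7 * M ≤ R)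
    (hbox : ∀ t ∈ Icc t₁ t₂, ∀ r ∈ Icc M R, ∀ θ ∈ Icc 0 π, boxPoint φ₀ t r θ ∈ W₀)
    (hfar0 : ∀ t ∈ Icc t₁ t₂, ∀ θ ∈ Icc 0 π, G (boxPoint φ₀ t R θ) = 0)
    (hfar1 : ∀ t ∈ Icc t₁ t₂, ∀ θ ∈ Icc 0 π, ∀ i, pd i G (boxPoint φ₀ t R θ) = 0) :
    (∫ t in t₁..t₂, ∫ θ in (0 : ℝ)..π, ∫ r in (23 / 21 * M)..(8 / 7 * M), slabDensity M G (boxPoint φ₀ t r θ)) ≤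
      127 * 10 ^ 8 * M ^ 2 * ∫ θ in (0 : ℝ)..π, ∫ r in M..R, tEnergy M M G (boxPoint φ₀ t₁ r θ) := by
  have hπ : (0 : ℝ) ≤ π := pi_pos.le
  have hM0 := hM.ne'
  have hMR : M ≤ R := by linarith
  have hab : 23 / 21 * M ≤ 8 / 7 * M := by linarith
  have hMa : M ≤ 23 / 21 * M := by linarith
  have ht₁ : t₁ ∈ Icc t₁ t₂ := left_mem_Icc.mpr ht
  have ht₂ : t₂ ∈ Icc t₁ t₂ := right_mem_Icc.mpr ht
  -- the profiles
  have hf := contDiff_mzProfileR_gw hM0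
  have hh := contDiff_mzProfileT_gw hM0
  have hw := contDiff_gwLag hM0
  have hv := contDiff_gwJ hM0
  have hv₁ := contDiff_gwJ₁' hM0
  have hvd := hasDerivAt_gwJ hM0
  -- smoothness of the densities on `W₀`
  obtain ⟨cD, cFl, cTh, cB⟩ := contDiffOn_mult (M := M) (a := M) hW₀ hG hf hh hw
  obtain ⟨cJD, cJF, cJB⟩ := contDiffOn_j (M := M) hW₀ hG hv hv₁
  obtain ⟨sT, -, -⟩ := contDiffOn_tEnergy_tFlux (M := M) (a := M) hW₀ hG
  have h0' := contDiffOn_pd hW₀ hG 0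
  have h1 := contDiffOn_pd hW₀ hG 1
  have h2 := contDiffOn_pd hW₀ hG 2
  have hc : ∀ j : Fin 4, ContDiffOn ℝ ∞ (fun q : E4 ↦ q j) W₀ := fun j ↦ (Kerr.contDiff_coord j).contDiffOn
  have hsin : ContDiffOn ℝ ∞ (fun q : E4 ↦ sin (q 2)) W₀ := contDiff_sin.comp_contDiffOn (hc 2)
  have sG2 : ContDiffOn ℝ ∞ (fun q ↦ sin (q 2) * G q ^ 2) W₀ := hsin.mul (hG.pow 2)
  have sH : ContDiffOn ℝ ∞ (fun q ↦ 4 * (sin (q 2) * ((q 1 - M) ^ 2 * pd 1 G q ^ 2))) W₀ :=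
    contDiffOn_const.mul (hsin.mul ((((hc 1).sub contDiffOn_const).pow 2).mul (h1.pow 2)))
  have sSD : ContDiffOn ℝ ∞ (slabDensity M G) W₀ := by
    unfold slabDensity
    exact hsin.mul (((contDiffOn_const.mul (hG.pow 2)).add (contDiffOn_const.mul ((h0'.pow 2).add
      (h1.pow 2)))).add (contDiffOn_const.mul (h2.pow 2)))
  -- the current: `e = −(e_mult + e_J)`, `b = −bulk_mult + bulk_J`, `f = F_mult + F_J`, `g = Θ_mult`
  obtain ⟨e, he⟩ : ∃ e : E4 → ℝ, e = -(multDensity M M (mzProfileR M (gwSeed M)) (mzProfileT M (gwSeed M)) (gwLag M) G + jDensity M (gwJ M) G) := ⟨_, rfl⟩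
  obtain ⟨b, hb⟩ : ∃ b : E4 → ℝ, b = fun q ↦ -multBulk M M (mzProfileR M (gwSeed M)) (mzProfileT M (gwSeed M)) (gwLag M) G q + jBulk M (gwJ M) (gwJ₁ M) G q :=
    ⟨_, rfl⟩
  obtain ⟨f, hfdef⟩ : ∃ f : E4 → ℝ, f = multFluxR M M (mzProfileR M (gwSeed M)) (mzProfileT M (gwSeed M)) (gwLag M) G + jFluxR M (gwJ M) G := ⟨_, rfl⟩
  obtain ⟨g, hg⟩ : ∃ g : E4 → ℝ, g = multFluxTheta (mzProfileR M (gwSeed M)) (mzProfileT M (gwSeed M)) (gwLag M) G := ⟨_, rfl⟩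
  have ce : ContDiffOn ℝ ∞ e W₀ := by rw [he]; exact (cD.add cJD).neg
  have cf : ContDiffOn ℝ ∞ f W₀ := by rw [hfdef]; exact cFl.add cJF
  have cb : ContinuousOn b W₀ := by
    rw [hb]; exact cB.neg.add cJB
  have cg : ContDiffOn ℝ ∞ g W₀ := by rw [hg]; exact cTh
  -- the pointwise divergence identity on `W₀`
  have hid : ∀ q ∈ W₀, pd 0 e q + b q = pd 1 f q + pd 2 g q := by
    intro q hq
    have hm := mult_divergence_eq_zero (M := M) (a := M) hW₀ hG hP hf hh hw q hq
    have hj := j_identity (M := M) hW₀ hvd hG hq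
    simp only at hj
    have e0 : pd 0 e q = -(pd 0 (multDensity M M (mzProfileR M (gwSeed M)) (mzProfileT M (gwSeed M)) (gwLag M) G) q + pd 0 (jDensity M (gwJ M) G) q) := by
      rw [he, pd_neg, pd_add hW₀ cD cJD 0 hq]; rfl
    have e1 : pd 1 f q = pd 1 (multFluxR M M (mzProfileR M (gwSeed M)) (mzProfileT M (gwSeed M)) (gwLag M) G) q + pd 1 (jFluxR M (gwJ M) G) q := by
      rw [hfdef, pd_add hW₀ cFl cJF 1 hq]; rfl
    rw [e0, e1, hb, hg]
    simp only
    linarith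
  -- Stokes on the box
  have hstokes := box_divergence_identity hW₀ ce cf cg cb hid ht hMR hbox
  -- the polar terms vanish
  have hpole : (∫ t in t₁..t₂, ∫ r in M..R, (g (boxPoint φ₀ t r π) - g (boxPoint φ₀ t r 0))) = 0 := by
    have h : ∀ t r, g (boxPoint φ₀ t r π) - g (boxPoint φ₀ t r 0) = 0 := by
      intro t r
      obtain ⟨hπ', h0⟩ := multFluxTheta_poles (mzProfileR M (gwSeed M)) (mzProfileT M (gwSeed M)) (gwLag M) G φ₀ t r
      rw [hg, hπ', h0, sub_self]
    simp only [h, intervalIntegral.integral_zero]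
  -- the radial fluxes: the outer one vanishes, the inner one is minus the horizon `T`-flux
  have hfluxR : ∀ t ∈ Icc t₁ t₂, ∀ θ : ℝ, θ ∈ Icc 0 π → f (boxPoint φ₀ t R θ) = 0 := by
    intro t ht' θ hθ
    have hG0 := hfar0 t ht' θ hθ
    have hpd := hfar1 t ht' θ hθ
    rw [hfdef]
    simp only [Pi.add_apply, multFluxR, radMultFluxR, timeMultFluxR, lagFluxR, tFluxR, jFluxR, hG0, hpd,
      mul_zero, add_zero, zero_pow two_ne_zero, sub_self]
  obtain ⟨hRM, hTM⟩ := gwProfiles_horizon hM0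
  have hfluxM : ∀ t θ : ℝ, f (boxPoint φ₀ t M θ) = -(2 * M ^ 2 * sin θ * pd 0 G (boxPoint φ₀ t M θ) ^ 2) := by
    intro t θ
    rw [hfdef, Pi.add_apply, multFluxR_extremal_horizon M (mzProfileR M (gwSeed M)) (mzProfileT M (gwSeed M)) (gwLag M) G (boxPoint_apply_one φ₀ t M θ),
      jFluxR_horizon (gwJ M) G (boxPoint_apply_one φ₀ t M θ), hRM, hTM]
    simp only [boxPoint_apply_two]
    ring
  have hflux : (∫ t in t₁..t₂, ∫ θ in (0 : ℝ)..π, (f (boxPoint φ₀ t R θ) - f (boxPoint φ₀ t M θ))) =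
      ∫ t in t₁..t₂, ∫ θ in (0 : ℝ)..π, 2 * M ^ 2 * sin θ * pd 0 G (boxPoint φ₀ t M θ) ^ 2 := by
    refine intervalIntegral.integral_congr fun t ht' ↦ ?_
    rw [uIcc_of_le ht] at ht'
    refine intervalIntegral.integral_congr fun θ hθ ↦ ?_
    rw [uIcc_of_le hπ] at hθ
    rw [hfluxR t ht' θ hθ, hfluxM t θ]
    ring
  rw [hpole, add_zero, hflux] at hstokes
  -- the `T`-energy identity and its consequences
  have hfarT : ∀ t ∈ Icc t₁ t₂, ∀ θ ∈ Icc (0 : ℝ) π, tFluxR M M G (boxPoint φ₀ t R θ) = 0 := by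
    intro t ht' θ hθ
    simp only [tFluxR, hfar1 t ht' θ hθ, mul_zero, add_zero, zero_pow two_ne_zero]
  have hTcons := tEnergy_extremal_conservation hW₀ hG hP ht hMR hbox hfarT
  have hT0 : ∀ t ∈ Icc t₁ t₂, 0 ≤ ∫ θ in (0 : ℝ)..π, ∫ r in M..R, tEnergy M M G (boxPoint φ₀ t r θ) := by
    intro t _
    refine intervalIntegral.integral_nonneg hπ fun θ hθ ↦ intervalIntegral.integral_nonneg hMR fun r hr ↦ ?_
    have hs : 0 ≤ sin θ := sin_nonneg_of_nonneg_of_le_pi hθ.1 hθ.2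
    simp only [tEnergy, boxPoint_apply_one, boxPoint_apply_two]
    have hΔ : (0 : ℝ) ≤ r ^ 2 - 2 * M * r + M ^ 2 := by nlinarith [sq_nonneg (r - M)]
    have hSg : (0 : ℝ) ≤ r ^ 2 + M ^ 2 * cos θ ^ 2 + 2 * M * r := by
      have : M ≤ r := hr.1
      nlinarith [sq_nonneg (M * cos θ)]
    positivity
  -- the leaf terms: `±e ≤ 7 e_T + 7 sin θ G²` pointwise, then Hardy along the lines
  have leaf : ∀ t ∈ Icc t₁ t₂, ∀ σ : ℝ, (σ = 1 ∨ σ = -1) →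
      (∫ θ in (0 : ℝ)..π, ∫ r in M..R, σ * e (boxPoint φ₀ t r θ)) ≤
        63 * ∫ θ in (0 : ℝ)..π, ∫ r in M..R, tEnergy M M G (boxPoint φ₀ t r θ) := by
    intro t ht' σ hσ
    have hσ1 : |σ| = 1 := by rcases hσ with h | h <;> simp [h]
    -- pointwise
    have step1 : (∫ θ in (0 : ℝ)..π, ∫ r in M..R, σ * e (boxPoint φ₀ t r θ)) ≤
        ∫ θ in (0 : ℝ)..π, ∫ r in M..R, (7 * tEnergy M M G (boxPoint φ₀ t r θ) +
          7 * (sin ((boxPoint φ₀ t r θ) 2) * G (boxPoint φ₀ t r θ) ^ 2)) := by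
      refine box2_integral_mono (F := fun q ↦ σ * e q)
        (G := fun q ↦ 7 * tEnergy M M G q + 7 * (sin (q 2) * G q ^ 2))
        (continuousOn_const.mul ce.continuousOn) ((contDiffOn_const.mul sT).add (contDiffOn_const.mul sG2)).continuousOn
        hMR (fun r hr θ hθ ↦ hbox t ht' r hr θ hθ) fun r hr θ hθ ↦ ?_
      have hq1 : M ≤ (boxPoint φ₀ t r θ) 1 := by simpa using hr.1
      have hqθ : (boxPoint φ₀ t r θ) 2 ∈ Icc 0 π := by simpa using hθ
      have hbd := abs_multDensity_add_jDensity_le hM G hq1 hqθ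
      have hJ0 := jDensity_nonneg hM G hq1 hqθ
      have habs : σ * e (boxPoint φ₀ t r θ) ≤ |e (boxPoint φ₀ t r θ)| := by
        have := neg_abs_le (e (boxPoint φ₀ t r θ))
        have := le_abs_self (e (boxPoint φ₀ t r θ))
        rcases hσ with h | h <;> rw [h] <;> linarith
      have he' : |e (boxPoint φ₀ t r θ)| ≤ |multDensity M M (mzProfileR M (gwSeed M)) (mzProfileT M (gwSeed M)) (gwLag M) G (boxPoint φ₀ t r θ)| +
          jDensity M (gwJ M) G (boxPoint φ₀ t r θ) := by
        rw [he, Pi.neg_apply, Pi.add_apply, abs_neg]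
        refine (abs_add_le _ _).trans ?_
        rw [abs_of_nonneg hJ0]
      linarith
    -- split the right-hand side
    have step2 : (∫ θ in (0 : ℝ)..π, ∫ r in M..R, (7 * tEnergy M M G (boxPoint φ₀ t r θ) +
          7 * (sin ((boxPoint φ₀ t r θ) 2) * G (boxPoint φ₀ t r θ) ^ 2))) =
        7 * (∫ θ in (0 : ℝ)..π, ∫ r in M..R, tEnergy M M G (boxPoint φ₀ t r θ)) +
          7 * ∫ θ in (0 : ℝ)..π, ∫ r in M..R, sin ((boxPoint φ₀ t r θ) 2) * G (boxPoint φ₀ t r θ) ^ 2 := by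
      rw [box2_integral_add (F := fun q ↦ 7 * tEnergy M M G q) (G := fun q ↦ 7 * (sin (q 2) * G q ^ 2))
        (contDiffOn_const.mul sT).continuousOn (contDiffOn_const.mul sG2).continuousOn hMR
        (fun r hr θ hθ ↦ hbox t ht' r hr θ hθ)]
      simp only [intervalIntegral.integral_const_mul]
    -- Hardy along each line
    have step3 : (∫ θ in (0 : ℝ)..π, ∫ r in M..R, sin ((boxPoint φ₀ t r θ) 2) * G (boxPoint φ₀ t r θ) ^ 2) ≤
        ∫ θ in (0 : ℝ)..π, ∫ r in M..R, 4 * (sin ((boxPoint φ₀ t r θ) 2) *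
          (((boxPoint φ₀ t r θ) 1 - M) ^ 2 * pd 1 G (boxPoint φ₀ t r θ) ^ 2)) := by
      refine theta_integral_mono_of_line (F := fun q ↦ sin (q 2) * G q ^ 2)
        (G := fun q ↦ 4 * (sin (q 2) * ((q 1 - M) ^ 2 * pd 1 G q ^ 2)))
        sG2.continuousOn sH.continuousOn hMR hMR (fun r hr θ hθ ↦ hbox t ht' r hr θ hθ)
        (fun r hr θ hθ ↦ hbox t ht' r hr θ hθ) fun θ hθ ↦ ?_
      simp only [boxPoint_apply_two, boxPoint_apply_one]
      rw [intervalIntegral.integral_const_mul, intervalIntegral.integral_const_mul,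
        intervalIntegral.integral_const_mul]
      have hH := line_sq_le_hardy hW₀ hG hMR (fun r hr ↦ hbox t ht' r hr θ hθ) (hfar0 t ht' θ hθ) (φ₀ := φ₀)
      have hs : 0 ≤ sin θ := sin_nonneg_of_nonneg_of_le_pi hθ.1 hθ.2
      nlinarith [mul_le_mul_of_nonneg_left hH hs]
    -- the weighted derivative is dominated by the `T`-energy density
    have step4 : (∫ θ in (0 : ℝ)..π, ∫ r in M..R, 4 * (sin ((boxPoint φ₀ t r θ) 2) *
          (((boxPoint φ₀ t r θ) 1 - M) ^ 2 * pd 1 G (boxPoint φ₀ t r θ) ^ 2))) ≤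
        ∫ θ in (0 : ℝ)..π, ∫ r in M..R, 8 * tEnergy M M G (boxPoint φ₀ t r θ) := by
      refine box2_integral_mono (F := fun q ↦ 4 * (sin (q 2) * ((q 1 - M) ^ 2 * pd 1 G q ^ 2)))
        (G := fun q ↦ 8 * tEnergy M M G q) sH.continuousOn (contDiffOn_const.mul sT).continuousOn hMR
        (fun r hr θ hθ ↦ hbox t ht' r hr θ hθ) fun r hr θ hθ ↦ ?_
      have hs : 0 ≤ sin θ := sin_nonneg_of_nonneg_of_le_pi hθ.1 hθ.2
      have hrM : M ≤ r := hr.1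
      simp only [tEnergy, boxPoint_apply_one, boxPoint_apply_two]
      have hSg : (0 : ℝ) ≤ r ^ 2 + M ^ 2 * cos θ ^ 2 + 2 * M * r := by nlinarith [sq_nonneg (M * cos θ)]
      have h1 : 0 ≤ sin θ * ((r ^ 2 + M ^ 2 * cos θ ^ 2 + 2 * M * r) * pd 0 G (boxPoint φ₀ t r θ) ^ 2) := by
        positivity
      have h2 : 0 ≤ sin θ * pd 2 G (boxPoint φ₀ t r θ) ^ 2 := by positivity
      have e : r ^ 2 - 2 * M * r + M ^ 2 = (r - M) ^ 2 := by ring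
      rw [e]
      nlinarith [h1, h2]
    have step4s : (∫ θ in (0 : ℝ)..π, ∫ r in M..R, 8 * tEnergy M M G (boxPoint φ₀ t r θ)) =
        8 * ∫ θ in (0 : ℝ)..π, ∫ r in M..R, tEnergy M M G (boxPoint φ₀ t r θ) := by
      simp only [intervalIntegral.integral_const_mul]
    rw [step2] at step1
    rw [step4s] at step4
    linarith [hT0 t ht']
  -- the two leaves
  have hleaf1 := leaf t₁ ht₁ 1 (Or.inl rfl)
  have hleaf2 := leaf t₂ ht₂ (-1) (Or.inr rfl)
  simp only [one_mul] at hleaf1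
  have hleaf2' : -(∫ θ in (0 : ℝ)..π, ∫ r in M..R, e (boxPoint φ₀ t₂ r θ)) ≤
      63 * ∫ θ in (0 : ℝ)..π, ∫ r in M..R, tEnergy M M G (boxPoint φ₀ t₂ r θ) := by
    have h : (∫ θ in (0 : ℝ)..π, ∫ r in M..R, -1 * e (boxPoint φ₀ t₂ r θ)) =
        -(∫ θ in (0 : ℝ)..π, ∫ r in M..R, e (boxPoint φ₀ t₂ r θ)) := by
      simp only [neg_mul, one_mul, intervalIntegral.integral_neg]
    rw [h] at hleaf2
    exact hleaf2
  -- the bulk on the whole box bounds the bulk on the slab box, which bounds the slab density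
  have hboxS : ∀ t ∈ Icc t₁ t₂, ∀ r ∈ Icc (23 / 21 * M) (8 / 7 * M), ∀ θ ∈ Icc 0 π, boxPoint φ₀ t r θ ∈ W₀ :=
    fun t ht' r hr θ hθ ↦ hbox t ht' r ⟨hMa.trans hr.1, hr.2.trans hR⟩ θ hθ
  have lower1 : (∫ t in t₁..t₂, ∫ θ in (0 : ℝ)..π, ∫ r in (23 / 21 * M)..(8 / 7 * M), b (boxPoint φ₀ t r θ)) ≤
      ∫ t in t₁..t₂, ∫ θ in (0 : ℝ)..π, ∫ r in M..R, b (boxPoint φ₀ t r θ) := by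
    refine t_theta_integral_mono_of_line cb cb ht hab hMR hboxS hbox fun t ht' θ hθ ↦ ?_
    have hl : Continuous fun r : ℝ ↦ boxPoint φ₀ t r θ :=
      (continuous_boxPoint φ₀).comp (Continuous.prodMk continuous_const
        (Continuous.prodMk continuous_id continuous_const))
    have hco : ContinuousOn (fun r ↦ b (boxPoint φ₀ t r θ)) (Icc M R) :=
      cb.comp hl.continuousOn fun r hr ↦ hbox t ht' r hr θ hθ
    refine intervalIntegral.integral_mono_interval hMa hab hR ?_ (hco.intervalIntegrable_of_Icc hMR)
    refine MeasureTheory.ae_restrict_of_forall_mem measurableSet_Ioc fun r hr ↦ ?_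
    simp only [Pi.zero_apply, hb]
    exact gwGood_nonneg hM (G := G) (q := boxPoint φ₀ t r θ) (by simpa using hr.1.le) (by simpa using hθ)
  have lower2 : (∫ t in t₁..t₂, ∫ θ in (0 : ℝ)..π, ∫ r in (23 / 21 * M)..(8 / 7 * M),
      1 / 10 ^ 8 / M ^ 2 * slabDensity M G (boxPoint φ₀ t r θ)) ≤
      ∫ t in t₁..t₂, ∫ θ in (0 : ℝ)..π, ∫ r in (23 / 21 * M)..(8 / 7 * M), b (boxPoint φ₀ t r θ) := by
    refine box3_integral_mono (F := fun q ↦ 1 / 10 ^ 8 / M ^ 2 * slabDensity M G q) (G := b)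
      (continuousOn_const.mul sSD.continuousOn) cb ht hab hboxS fun t ht' r hr θ hθ ↦ ?_
    have h := gwGood_slab hM (G := G) (q := boxPoint φ₀ t r θ) (by simpa using hr) (by simpa using hθ)
    simpa only [slabDensity, hb] using h
  have lower2s : (∫ t in t₁..t₂, ∫ θ in (0 : ℝ)..π, ∫ r in (23 / 21 * M)..(8 / 7 * M),
      1 / 10 ^ 8 / M ^ 2 * slabDensity M G (boxPoint φ₀ t r θ)) =
      1 / 10 ^ 8 / M ^ 2 * ∫ t in t₁..t₂, ∫ θ in (0 : ℝ)..π, ∫ r in (23 / 21 * M)..(8 / 7 * M),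
        slabDensity M G (boxPoint φ₀ t r θ) := by
    simp only [intervalIntegral.integral_const_mul]
  -- the horizon flux is non-negative
  have hHF : 0 ≤ ∫ t in t₁..t₂, ∫ θ in (0 : ℝ)..π, 2 * M ^ 2 * sin θ * pd 0 G (boxPoint φ₀ t M θ) ^ 2 :=
    intervalIntegral.integral_nonneg ht fun t _ ↦ intervalIntegral.integral_nonneg hπ
      fun θ hθ ↦ mul_nonneg (mul_nonneg (by positivity) (sin_nonneg_of_nonneg_of_le_pi hθ.1 hθ.2))
        (sq_nonneg _)
  -- the slab integral is non-negative (for the final rounding of the constant)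
  have hSD0 : 0 ≤ ∫ t in t₁..t₂, ∫ θ in (0 : ℝ)..π, ∫ r in (23 / 21 * M)..(8 / 7 * M),
      slabDensity M G (boxPoint φ₀ t r θ) :=
    intervalIntegral.integral_nonneg ht fun t _ ↦ intervalIntegral.integral_nonneg hπ fun θ hθ ↦
      intervalIntegral.integral_nonneg hab fun r _ ↦
        slabDensity_nonneg hM.le G (q := boxPoint φ₀ t r θ) (by simpa using hθ)
  -- assemble
  rw [lower2s] at lower2
  have hTE1 := hT0 t₁ ht₁
  have hM2 : (0 : ℝ) < 10 ^ 8 * M ^ 2 := by positivity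
  have key : 1 / 10 ^ 8 / M ^ 2 * (∫ t in t₁..t₂, ∫ θ in (0 : ℝ)..π, ∫ r in (23 / 21 * M)..(8 / 7 * M),
      slabDensity M G (boxPoint φ₀ t r θ)) ≤
      126 * ∫ θ in (0 : ℝ)..π, ∫ r in M..R, tEnergy M M G (boxPoint φ₀ t₁ r θ) := by
    linarith
  have e : (∫ t in t₁..t₂, ∫ θ in (0 : ℝ)..π, ∫ r in (23 / 21 * M)..(8 / 7 * M),
      slabDensity M G (boxPoint φ₀ t r θ)) = 10 ^ 8 * M ^ 2 * (1 / 10 ^ 8 / M ^ 2 *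
        ∫ t in t₁..t₂, ∫ θ in (0 : ℝ)..π, ∫ r in (23 / 21 * M)..(8 / 7 * M), slabDensity M G (boxPoint φ₀ t r θ)) := by
    field_simp
  rw [e]
  nlinarith [mul_le_mul_of_nonneg_left key hM2.le]

/-- The Hardy density is at most `2 sin θ G²` on `{r ≥ M}`, `θ ∈ [0, π]` (the companion of
`jDensity_nonneg`; v2). [cite: GiorgiWan2024, §4.2] -/
theorem jDensity_le (hM : 0 < M) (G : E4 → ℝ) {q : E4} (hr : M ≤ q 1) (hθ : q 2 ∈ Icc 0 π) :
    jDensity M (gwJ M) G q ≤ 2 * (sin (q 2) * G q ^ 2) := by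
  have hs : 0 ≤ sin (q 2) := sin_nonneg_of_nonneg_of_le_pi hθ.1 hθ.2
  have hc : cos (q 2) ^ 2 ≤ 1 := by
    have := sin_sq_add_cos_sq (q 2); nlinarith [sq_nonneg (sin (q 2))]
  obtain ⟨-, -, -, -, -, hJ⟩ := profile_bounds hM hr hc
  have e2 : jDensity M (gwJ M) G q =
      1 / 2 * M * q 1 * (q 1 ^ 2 + M ^ 2 * cos (q 2) ^ 2) * gwJ M (q 1) * (sin (q 2) * G q ^ 2) := by
    simp only [jDensity]; ring
  rw [e2]
  exact mul_le_mul_of_nonneg_right hJ (by positivity)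

end Coord

/-! ### The class -/

section Class

variable [Kerr.Facts] [Kerr.SliceFacts] {M r₀ : ℝ} {U₀ : Set (Kerr.region M r₀)} {Φ : E4 → ℝ}

/-- **Integrated local energy decay on the transition slab for Aretakis's class** — the input of
`Aretakis2012_pointwiseDecay_of_slabILED`. For `Φ ∈ C^∞(E4)` axisymmetric, solving `□_{g_{M,M}}Φ = 0`
on an open `U₀ ⊇ {r ≥ M, t* ≥ 0}` of the extremal Kerr region (`0 < r₀ < M`), with Cauchy data
supported in `|x| ≤ ρ` on `{t* = 0}`: for all `τ ≥ 0`,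
`∫_0^τ∫₀^π∫_{23M/21}^{8M/7} slabDensity M (Φ ∘ κ) ≤ 127·10⁸ M² E_T(0; [M, max(ρ, 2M) + 2])`
(`morawetz_box_estimate` on `[0, τ] × [M, max(ρ, 2M) + 2 + τ]`, the outer face beyond the support by
finite speed of propagation, the data energy independent of the box). This is Thm. 1 of Aretakis
(integrated decay) restricted to the slab, equivalently Cor. 1.2 of Giorgi–Wan, for the class, by a
physical-space current regular across `𝓗⁺`. [cite: GiorgiWan2024, Cor. 1.2] -/
theorem slabILED_of_class (hM : 0 < M) (hr₀ : r₀ ∈ Set.Ioo 0 M) (hU₀ : IsOpen U₀)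
    (hKU : {x : Kerr.region M r₀ | Kerr.rPlus M M ≤ Kerr.radius M (x : E4) ∧ 0 ≤ (x : E4) 0} ⊆ U₀)
    (hΦ : ContDiff ℝ ∞ Φ) (haxi : ∀ (β : ℝ) (z : E4), Φ (E4.axialRotation β z) = Φ z)
    (hsol : ∀ x ∈ U₀, (Kerr.smoothMetric M M r₀).toPseudoRiemannianMetric.dalembertian
      (fun y : Kerr.region M r₀ ↦ Φ y) x = 0)
    {ρ : ℝ} (hloc : ∀ x ∈ U₀, (x : E4) 0 = 0 → ρ < E4.spatialNorm (x : E4) → Φ x = 0 ∧ fderiv ℝ Φ x = 0)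
    {τ : ℝ} (hτ : 0 ≤ τ) :
    (∫ t in (0 : ℝ)..τ, ∫ θ in (0 : ℝ)..π, ∫ r in (23 / 21 * M)..(8 / 7 * M),
        slabDensity M (Kerr.starPull M Φ) (boxPoint 0 t r θ)) ≤
      127 * 10 ^ 8 * M ^ 2 * ∫ θ in (0 : ℝ)..π, ∫ r in M..(max ρ (2 * M) + 2),
        tEnergy M M (Kerr.starPull M Φ) (boxPoint 0 0 r θ) := by
  obtain ⟨hr₀pos, hr₀M⟩ := hr₀
  have hΦ' : ∀ x ∈ U₀, ContDiffAt ℝ ∞ Φ x := fun x _ ↦ hΦ.contDiffAt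
  have haxi' : ∀ (β : ℝ) (z : E4), 0 < Kerr.radius M z → Φ (E4.axialRotation β z) = Φ z := fun β z _ ↦ haxi β z
  have hG : ContDiff ℝ ∞ (Kerr.starPull M Φ) := hΦ.comp (Kerr.contDiff_starChart M)
  have hd : Differentiable ℝ Φ := hΦ.differentiable (by simp)
  have hρ : 2 * M ≤ max ρ (2 * M) := le_max_right _ _
  -- the outer radius for this `τ`
  set r₂ : ℝ := max ρ (2 * M) + 2 + τ with hr₂def
  have hr₂ : max ρ (2 * M) + 1 + τ < r₂ := by rw [hr₂def]; linarith
  have hMr₂ : M ≤ r₂ := by rw [hr₂def]; linarith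
  have hR : 8 / 7 * M ≤ r₂ := by rw [hr₂def]; linarith
  have hρ₂ : max ρ (2 * M) + 2 ≤ r₂ := by rw [hr₂def]; linarith
  -- the coordinate open set and the separated equation off the axis
  obtain ⟨V, hVdef⟩ : ∃ V : Set E4, V = Subtype.val '' U₀ := ⟨_, rfl⟩
  have hV : IsOpen V := by rw [hVdef]; exact (Kerr.region M r₀).isOpen.isOpenMap_subtype_val U₀ hU₀
  obtain ⟨W₀, hW₀def⟩ : ∃ W₀ : Set E4, W₀ = {q : E4 | 0 < q 1 ∧ Kerr.starChart M q ∈ V} := ⟨_, rfl⟩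
  have hW₀ : IsOpen W₀ := by
    rw [hW₀def]
    exact (isOpen_lt continuous_const (PiLp.continuous_apply 2 _ 1)).inter
      (hV.preimage (Kerr.contDiff_starChart M (n := 0)).continuous)
  have hGW : ContDiffOn ℝ ∞ (Kerr.starPull M Φ) W₀ := hG.contDiffOn
  obtain ⟨-, -, -, hsep, -⟩ := separated_equations_starPull hU₀ hΦ' haxi' hsol
  have hP : ∀ q ∈ W₀, Real.sin (q 2) ≠ 0 →
      radOp M M (Kerr.starPull M Φ) q + angOp M (Kerr.starPull M Φ) q = 0 := by
    intro q hq hs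
    rw [hW₀def] at hq
    rw [hVdef] at hq
    exact hsep q ⟨hq.1, hs, hq.2⟩
  -- the box lies in `W₀`
  have hK'reg : ∀ x : E4, Kerr.rPlus M M ≤ Kerr.radius M x ∧ 0 ≤ x 0 → x ∈ Kerr.region M r₀ := by
    intro x hx
    rw [Kerr.mem_region]
    have h1 := hx.1
    rw [Kerr.rPlus_self] at h1
    exact max_lt (by linarith) (by linarith)
  have hbox : ∀ t ∈ Icc 0 τ, ∀ r ∈ Icc M r₂, ∀ θ ∈ Icc 0 Real.pi, boxPoint 0 t r θ ∈ W₀ := by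
    intro t ht' r hr' θ _
    have hK := shellPoint_mem_horizonFutureSet hM ht'.1 hr'.1 θ 0
    rw [hW₀def]
    refine ⟨hM.trans_le hr'.1, ?_⟩
    rw [starChart_boxPoint, hVdef]
    exact ⟨⟨_, hK'reg _ hK⟩, hKU hK, rfl⟩
  -- far field on the outer cylinder
  have hfar : ∀ t ∈ Icc 0 τ, ∀ θ : ℝ, Φ (shellPoint M t r₂ θ 0) = 0 ∧
      fderiv ℝ Φ (shellPoint M t r₂ θ 0) = 0 := fun t ht θ ↦
    fderiv_shellPoint_eq_zero_of_far hM ⟨hr₀pos, hr₀M⟩ hU₀ hKU hΦ' hsol hloc hr₂ ht.1 ht.2 θ 0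
  have hfar0 : ∀ t ∈ Icc 0 τ, ∀ θ ∈ Icc 0 Real.pi, Kerr.starPull M Φ (boxPoint 0 t r₂ θ) = 0 := by
    intro t ht θ _
    rw [Kerr.starPull_apply, starChart_boxPoint]
    exact (hfar t ht θ).1
  have hfar1 : ∀ t ∈ Icc 0 τ, ∀ θ ∈ Icc 0 Real.pi, ∀ i, pd i (Kerr.starPull M Φ) (boxPoint 0 t r₂ θ) = 0 := by
    intro t ht θ _ i
    rw [pd_starPull_boxPoint (hd _), (hfar t ht θ).2]
    rfl
  -- the estimate in coordinates, and the data energy beyond the support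
  have hbd := morawetz_box_estimate hM hW₀ hGW hP hτ hR hbox hfar0 hfar1
  have hE := tEnergy_data_far_eq hM ⟨hr₀pos, hr₀M⟩ hU₀ hKU hΦ hsol hloc (φ₀ := 0) hρ₂
  rw [hE] at hbd
  exact hbd

/-- **The slab hypothesis of `Aretakis2012_pointwiseDecay_of_slabILED` holds for every member of the
class**, with `I = 127·10⁸ M² E_T(0; [M, max(ρ, 2M) + 2])`. [cite: GiorgiWan2024, Cor. 1.2] -/
theorem slabILED_uniform (hM : 0 < M) (hr₀ : r₀ ∈ Set.Ioo 0 M) (hU₀ : IsOpen U₀)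
    (hKU : {x : Kerr.region M r₀ | Kerr.rPlus M M ≤ Kerr.radius M (x : E4) ∧ 0 ≤ (x : E4) 0} ⊆ U₀)
    (hΦ : ContDiff ℝ ∞ Φ)
    (hsol : ∀ x ∈ U₀, (Kerr.smoothMetric M M r₀).toPseudoRiemannianMetric.dalembertian
      (fun y : Kerr.region M r₀ ↦ Φ y) x = 0)
    (hloc : ∃ ρ : ℝ, ∀ x ∈ U₀, (x : E4) 0 = 0 → ρ < E4.spatialNorm (x : E4) → Φ x = 0 ∧ fderiv ℝ Φ x = 0)
    (haxi : ∀ (β : ℝ) (z : E4), Φ (E4.axialRotation β z) = Φ z) :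
    ∃ I : ℝ, ∀ τ : ℝ, 0 ≤ τ →
      (∫ t in (0 : ℝ)..τ, ∫ θ in (0 : ℝ)..π, ∫ r in (23 / 21 * M)..(8 / 7 * M),
        slabDensity M (Kerr.starPull M Φ) (boxPoint 0 t r θ)) ≤ I := by
  obtain ⟨ρ, hρ⟩ := hloc
  exact ⟨_, fun τ hτ ↦ slabILED_of_class hM hr₀ hU₀ hKU hΦ haxi hsol hρ hτ⟩

end Class

end Literature.Barriers.FinalStateConjecture.Kerr

namespace Literature.Barriers.FinalStateConjecture

open Literature.Geometry.Lorentzian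
open Literature.Barriers.FinalStateConjecture.Kerr

/-- **Aretakis's integrated-decay input holds**: the hypothesis of
`Aretakis2012_pointwiseDecay_of_slabILED` — a uniform bound on the transition-slab spacetime integrals
for every member of the class — is a theorem (`Kerr.slabILED_uniform`). [cite: GiorgiWan2024, Cor. 1.2] -/
theorem slabILED_holds :
    ∀ [Kerr.Facts] [Kerr.SliceFacts] (M : ℝ), 0 < M → ∀ r₀ ∈ Set.Ioo 0 M,
      ∀ (U₀ : Set (Kerr.region M r₀)) (Φ : E4 → ℝ), IsOpen U₀ →
        {x : Kerr.region M r₀ | Kerr.rPlus M M ≤ Kerr.radius M (x : E4) ∧ 0 ≤ (x : E4) 0} ⊆ U₀ →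
        ContDiff ℝ ∞ Φ →
        (∀ x ∈ U₀, (Kerr.smoothMetric M M r₀).toPseudoRiemannianMetric.dalembertian
          (fun y : Kerr.region M r₀ ↦ Φ y) x = 0) →
        (∃ ρ : ℝ, ∀ x ∈ U₀, (x : E4) 0 = 0 → ρ < E4.spatialNorm (x : E4) →
          Φ x = 0 ∧ fderiv ℝ Φ x = 0) →
        (∀ (β : ℝ) (z : E4), Φ (E4.axialRotation β z) = Φ z) →
        ∃ I : ℝ, ∀ τ : ℝ, 0 ≤ τ →
          (∫ t in (0 : ℝ)..τ, ∫ θ in (0 : ℝ)..Real.pi, ∫ r in (23 / 21 * M)..(8 / 7 * M),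
            Literature.Geometry.Lorentzian.Kerr.StarCoord.slabDensity M (Kerr.starPull M Φ)
              (Literature.Geometry.Lorentzian.Kerr.StarCoord.boxPoint 0 t r θ)) ≤ I :=
  fun _ hM _ hr₀ _ _ hU₀ hKU hΦ hsol hloc haxi ↦ slabILED_uniform hM hr₀ hU₀ hKU hΦ hsol hloc haxi

end Literature.Barriers.FinalStateConjecture

end
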